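import Summits.BirchSwinnertonDyer.BirchSwinnertonDyer.Theorems.ClassRecordThreeEulerHalvesAtThreeCartanTorusCubeCutPSChar
import HarnessLib

/-!
# Crux 23422 line `cartan` v8′, stub (F2a), PRINCIPAL-SERIES half of the torus-cube cut — file PS-5a: REDUCTION MOD 3
# (`X̄ = X/3X = 𝔽₃^d`, `ρ̄(g)` = the matrix of `ρ(g)` mod 3) and the TRANSFER of the mod-3 line hypotheses from a
# `ρ̄`-stable hyperplane `W ⊂ X̄` to the `ℤ`-submodule `X_M = red⁻¹(W)`

Seat `bsd-stepL-cartan-f2a` g0 (explicit unit, pen g44 AUTOFILL #2 row (3′); `--supports stmt-BirchSwinnertonDyer-23422 --as helper`).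
Two definitions (reduction of vectors `red d : ℤ^d →ₗ[ℤ] 𝔽₃^d` and of endomorphisms `redEnd d f`, via `LinearMap.toMatrix'` and
`Matrix.map (Int.castRingHom (ZMod 3))`) with their API (`redEnd_red`, `redEnd_mul`, `redEnd_one`, `redEnd_sum`, `red_surjective`,
`red_eq_zero_iff`, `trace_redEnd`), the vanishing of `ρ̄`-fixed vectors (`red_eq_zero_of_fixed`, = `noFixedVectorModThree`), and the
TRANSFER theorems: for a `ρ̄`-stable `𝔽₃`-subspace `W ⊂ X̄ = 𝔽₃^d` the `ℤ`-submodule `X_M := red⁻¹(W)` satisfies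
* `hline_of_subspace` : `hline` (G-stable, `3X ⊆ X_M`, trivial quotient action, proper) from `W ≠ ⊤`, `ρ̄`-stability and `ρ̄(g)x̄ − x̄ ∈ W`;
* `hsimple_of_subspace` : `hsimple` from the simplicity of `W` as `𝔽₃[G]`-module (every `ρ̄`-stable subspace of `W` is `⊥` or `W`);
* `hcyc_of_subspace` : `hcyc` from `finrank W + 1 = d` (a hyperplane);
the shapes are VERBATIM those consumed by `psNonsplitNormLower_of_line` ∕ `psSplitNormSharp_of_line` ∕ `psNonsplitNormSharp_of_line`
(files PS-3, 3b, 3c). The subspace `W` itself (the image of the Steinberg module `St ⊗ 𝔽₃`) is constructed in files PS-5b–d.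
HONEST FRAMING: linear algebra of reduction mod 3; S-K1′ is NOT proved, no summit statement, no route item and no registered stub is
proved; BSD is proved for no curve. [folklore]
-/

namespace Summit.BirchSwinnertonDyer.BirchSwinnertonDyer.Theorems.CartanTorusCubeCut.PS

open Summit.BirchSwinnertonDyer.BirchSwinnertonDyer.Theorems.CartanDegree
open Summit.BirchSwinnertonDyer.BirchSwinnertonDyer.Theorems.CartanTorusCubeCut

set_option linter.dupNamespace false
set_option autoImplicit false

/-! ### Reduction mod 3 of vectors and endomorphisms of `ℤ^d` -/

section Red
variable (d : ℕ)

/-- reduction mod `3` of lattice vectors: `ℤ^d → 𝔽₃^d`. -/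
def red : (Fin d → ℤ) →ₗ[ℤ] (Fin d → ZMod 3) :=
  (Int.castAddHom (ZMod 3)).toIntLinearMap.compLeft (Fin d)

/-- reduction mod `3` of an endomorphism of `ℤ^d` (its matrix reduced mod `3`). -/
noncomputable def redEnd (f : (Fin d → ℤ) →ₗ[ℤ] (Fin d → ℤ)) : (Fin d → ZMod 3) →ₗ[ZMod 3] (Fin d → ZMod 3) :=
  Matrix.toLin' ((LinearMap.toMatrix' f).map (Int.castRingHom (ZMod 3)))

/-- `red` is entrywise reduction. -/
@[simp] theorem red_apply (x : Fin d → ℤ) (i : Fin d) : red d x i = ((x i : ℤ) : ZMod 3) := rfl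

/-- `red` is onto. -/
theorem red_surjective : Function.Surjective (red d) := by
  intro y
  refine ⟨fun i => ((y i).val : ℤ), ?_⟩
  funext i
  simp

/-- `red x = 0 ↔ x ∈ 3X`. -/
theorem red_eq_zero_iff (x : Fin d → ℤ) : red d x = 0 ↔ ∃ y : Fin d → ℤ, x = (3 : ℤ) • y := by
  constructor
  · intro h
    have hi : ∀ i, (3 : ℤ) ∣ x i := fun i => by
      have := congrFun h i
      simp only [red_apply, Pi.zero_apply] at this
      exact (ZMod.intCast_zmod_eq_zero_iff_dvd (x i) 3).1 this
    choose y hy using hi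
    exact ⟨y, funext fun i => by simp [hy i]⟩
  · rintro ⟨y, rfl⟩
    funext i
    simp only [red_apply, Pi.smul_apply, smul_eq_mul, Int.cast_mul, Pi.zero_apply]
    rw [show ((3 : ℤ) : ZMod 3) = 0 from rfl, zero_mul]

/-- membership in `3X` through `red`. -/
theorem red_sub_eq_zero_iff (x y : Fin d → ℤ) : red d x = red d y ↔ ∃ z : Fin d → ℤ, x - y = (3 : ℤ) • z := by
  rw [← red_eq_zero_iff, map_sub, sub_eq_zero]

/-- an endomorphism is given by its matrix. -/
theorem apply_eq_mulVec (f : (Fin d → ℤ) →ₗ[ℤ] (Fin d → ℤ)) (x : Fin d → ℤ) :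
    f x = (LinearMap.toMatrix' f).mulVec x := by
  rw [← Matrix.toLin'_apply, Matrix.toLin'_toMatrix']

/-- **`redEnd f ∘ red = red ∘ f`**. -/
theorem redEnd_red (f : (Fin d → ℤ) →ₗ[ℤ] (Fin d → ℤ)) (x : Fin d → ℤ) : redEnd d f (red d x) = red d (f x) := by
  rw [apply_eq_mulVec]
  funext i
  simp only [redEnd, Matrix.toLin'_apply, Matrix.mulVec, dotProduct, Matrix.map_apply, red_apply, eq_intCast,
    Int.cast_sum, Int.cast_mul]

/-- `redEnd` is multiplicative. -/
theorem redEnd_mul (f g : (Fin d → ℤ) →ₗ[ℤ] (Fin d → ℤ)) : redEnd d (f * g) = redEnd d f * redEnd d g := by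
  rw [redEnd, LinearMap.toMatrix'_mul, Matrix.map_mul, Matrix.toLin'_mul]
  rfl

/-- `redEnd 1 = 1`. -/
theorem redEnd_one : redEnd d 1 = 1 := by
  apply LinearMap.ext
  intro y
  obtain ⟨x, rfl⟩ := red_surjective d y
  rw [redEnd_red]
  rfl

/-- `redEnd` is additive. -/
theorem redEnd_add (f g : (Fin d → ℤ) →ₗ[ℤ] (Fin d → ℤ)) : redEnd d (f + g) = redEnd d f + redEnd d g := by
  rw [redEnd, map_add, Matrix.map_add _ (fun a b => map_add _ a b), map_add]
  rfl

/-- `redEnd 0 = 0`. -/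
theorem redEnd_zero : redEnd d 0 = 0 := by
  rw [redEnd, map_zero]
  have : (0 : Matrix (Fin d) (Fin d) ℤ).map (Int.castRingHom (ZMod 3)) = 0 := by
    ext i j; simp
  rw [this, map_zero]

/-- `redEnd` of a finite sum. -/
theorem redEnd_sum {ι : Type*} (s : Finset ι) (f : ι → (Fin d → ℤ) →ₗ[ℤ] (Fin d → ℤ)) :
    redEnd d (∑ i ∈ s, f i) = ∑ i ∈ s, redEnd d (f i) := by
  classical
  induction s using Finset.induction_on with
  | empty => rw [Finset.sum_empty, Finset.sum_empty, redEnd_zero]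
  | insert a s ha ih => rw [Finset.sum_insert ha, Finset.sum_insert ha, redEnd_add, ih]

/-- `redEnd` on integer multiples. -/
theorem redEnd_zsmul (n : ℤ) (f : (Fin d → ℤ) →ₗ[ℤ] (Fin d → ℤ)) : redEnd d (n • f) = (n : ZMod 3) • redEnd d f := by
  apply LinearMap.ext
  intro y
  obtain ⟨x, rfl⟩ := red_surjective d y
  rw [redEnd_red, LinearMap.smul_apply, LinearMap.smul_apply, redEnd_red, map_zsmul]
  funext i
  simp

/-- pointwise: `redEnd f` on `red x` for maps into a line. -/
theorem trace_redEnd (f : (Fin d → ℤ) →ₗ[ℤ] (Fin d → ℤ)) :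
    LinearMap.trace (ZMod 3) _ (redEnd d f) = ((LinearMap.trace ℤ _ f : ℤ) : ZMod 3) := by
  rw [redEnd, Matrix.trace_toLin'_eq, LinearMap.trace_eq_matrix_trace ℤ (Pi.basisFun ℤ (Fin d)) f,
    LinearMap.toMatrix_eq_toMatrix']
  simp [Matrix.trace, Matrix.map_apply]

end Red

/-! ### The reduced representation `ρ̄` of a Cartan torus lattice -/

section RhoBar
variable {q : ℕ} (𝓛 : CartanTorusLattice q)

/-- `ρ̄` is multiplicative. -/
theorem redEnd_rho_mul (g h : G q) :
    redEnd 𝓛.d (𝓛.ρ (g * h)) = redEnd 𝓛.d (𝓛.ρ g) * redEnd 𝓛.d (𝓛.ρ h) := by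
  rw [map_mul, redEnd_mul]

/-- `ρ̄(1) = 1`. -/
theorem redEnd_rho_one : redEnd 𝓛.d (𝓛.ρ 1) = 1 := by
  rw [map_one, redEnd_one]

/-- `ρ̄(g⁻¹) ρ̄(g) = 1`. -/
theorem redEnd_rho_inv_mul (g : G q) (y : Fin 𝓛.d → ZMod 3) :
    redEnd 𝓛.d (𝓛.ρ g⁻¹) (redEnd 𝓛.d (𝓛.ρ g) y) = y := by
  rw [← Module.End.mul_apply, ← redEnd_rho_mul, inv_mul_cancel, redEnd_rho_one, Module.End.one_apply]

/-- **no fixed vectors mod 3** (`noFixedVectorModThree`): a vector of `X̄` fixed by every `ρ̄(g)` is `0`. -/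
theorem red_eq_zero_of_fixed (v : Fin 𝓛.d → ℤ) (h : ∀ g : G q, redEnd 𝓛.d (𝓛.ρ g) (red 𝓛.d v) = red 𝓛.d v) :
    red 𝓛.d v = 0 := by
  have hg : ∀ g : G q, ∃ w : Fin 𝓛.d → ℤ, 𝓛.ρ g v - v = (3 : ℤ) • w := by
    intro g
    have := h g
    rw [redEnd_red] at this
    exact (red_sub_eq_zero_iff 𝓛.d _ _).1 this
  obtain ⟨w, hw⟩ := 𝓛.noFixedVectorModThree v hg
  rw [red_eq_zero_iff]
  exact ⟨w, hw⟩

end RhoBar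

/-! ### Transfer: from a `ρ̄`-stable hyperplane `W ⊂ X̄` to the mod-3 line `X_M = red⁻¹(W)` -/

section Transfer
variable {q : ℕ} (𝓛 : CartanTorusLattice q)
variable (W : Submodule (ZMod 3) (Fin 𝓛.d → ZMod 3))

/-- membership in `X_M = red⁻¹(W)`. -/
theorem mem_comap_red_iff (x : Fin 𝓛.d → ℤ) :
    x ∈ (W.restrictScalars ℤ).comap (red 𝓛.d) ↔ red 𝓛.d x ∈ W := by
  rw [Submodule.mem_comap, Submodule.restrictScalars_mem]

/-- **`hline`** for `X_M = red⁻¹(W)`: `G`-stable, contains `3X`, trivial quotient action, proper. -/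
theorem hline_of_subspace
    (hW : ∀ g : G q, ∀ w ∈ W, redEnd 𝓛.d (𝓛.ρ g) w ∈ W)
    (htriv : ∀ (g : G q) (y : Fin 𝓛.d → ZMod 3), redEnd 𝓛.d (𝓛.ρ g) y - y ∈ W)
    (hne : W ≠ ⊤) :
    (∀ g : G q, ∀ x ∈ (W.restrictScalars ℤ).comap (red 𝓛.d), 𝓛.ρ g x ∈ (W.restrictScalars ℤ).comap (red 𝓛.d)) ∧
    (∀ x, (3 : ℤ) • x ∈ (W.restrictScalars ℤ).comap (red 𝓛.d)) ∧
    (∀ (g : G q) (x : Fin 𝓛.d → ℤ), 𝓛.ρ g x - x ∈ (W.restrictScalars ℤ).comap (red 𝓛.d)) ∧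
    (W.restrictScalars ℤ).comap (red 𝓛.d) ≠ ⊤ := by
  refine ⟨fun g x hx => ?_, fun x => ?_, fun g x => ?_, fun htop => hne ?_⟩
  · rw [mem_comap_red_iff] at hx ⊢
    rw [← redEnd_red]
    exact hW g _ hx
  · rw [mem_comap_red_iff, (red_eq_zero_iff 𝓛.d _).2 ⟨x, rfl⟩]
    exact W.zero_mem
  · rw [mem_comap_red_iff, map_sub, ← redEnd_red]
    exact htriv g _
  · rw [eq_top_iff]
    intro y _
    obtain ⟨x, rfl⟩ := red_surjective 𝓛.d y
    have hx : x ∈ (W.restrictScalars ℤ).comap (red 𝓛.d) := by rw [htop]; trivial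
    exact (mem_comap_red_iff 𝓛 W x).1 hx

/-- a `ℤ`-submodule of `X̄ = 𝔽₃^d` is an `𝔽₃`-subspace (same carrier). -/
theorem exists_subspace_of_intSubmodule (L : Submodule ℤ (Fin 𝓛.d → ZMod 3)) :
    ∃ W' : Submodule (ZMod 3) (Fin 𝓛.d → ZMod 3), ∀ y, y ∈ W' ↔ y ∈ L :=
  ⟨AddSubgroup.toZModSubmodule 3 L.toAddSubgroup, fun _ => Iff.rfl⟩

/-- **`hsimple`** for `X_M = red⁻¹(W)` from the simplicity of `W`: a `G`-stable `L` with `3X ⊆ L ⊆ X_M` is `X_M` or lies in `3X`. -/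
theorem hsimple_of_subspace
    (hsimpleW : ∀ W' : Submodule (ZMod 3) (Fin 𝓛.d → ZMod 3),
      (∀ g : G q, ∀ w ∈ W', redEnd 𝓛.d (𝓛.ρ g) w ∈ W') → W' ≤ W → (W' = ⊥ ∨ W' = W)) :
    ∀ L : Submodule ℤ (Fin 𝓛.d → ℤ), (∀ g : G q, ∀ x ∈ L, 𝓛.ρ g x ∈ L) →
      (∀ x, (3 : ℤ) • x ∈ L) → L ≤ (W.restrictScalars ℤ).comap (red 𝓛.d) →
      (L = (W.restrictScalars ℤ).comap (red 𝓛.d) ∨ ∀ x ∈ L, ∃ y, x = (3 : ℤ) • y) := by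
  intro L hLG hL3 hLM
  -- the image of `L` in `X̄`
  obtain ⟨W', hW'⟩ := exists_subspace_of_intSubmodule 𝓛 (L.map (red 𝓛.d))
  have hmemW' : ∀ y, y ∈ W' ↔ ∃ x ∈ L, red 𝓛.d x = y := fun y => by rw [hW', Submodule.mem_map]
  have hW'G : ∀ g : G q, ∀ w ∈ W', redEnd 𝓛.d (𝓛.ρ g) w ∈ W' := by
    intro g w hw
    obtain ⟨x, hx, rfl⟩ := (hmemW' w).1 hw
    rw [redEnd_red]
    exact (hmemW' _).2 ⟨_, hLG g x hx, rfl⟩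
  have hW'le : W' ≤ W := by
    intro w hw
    obtain ⟨x, hx, rfl⟩ := (hmemW' w).1 hw
    exact (mem_comap_red_iff 𝓛 W x).1 (hLM hx)
  rcases hsimpleW W' hW'G hW'le with h0 | hWW
  · right
    intro x hx
    have : red 𝓛.d x = 0 := by
      have hxW' : red 𝓛.d x ∈ W' := (hmemW' _).2 ⟨x, hx, rfl⟩
      rw [h0] at hxW'
      exact (Submodule.mem_bot _).1 hxW'
    exact (red_eq_zero_iff 𝓛.d x).1 this
  · left
    refine le_antisymm hLM fun x hx => ?_
    rw [mem_comap_red_iff, ← hWW, hmemW'] at hx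
    obtain ⟨x', hx', hxx'⟩ := hx
    obtain ⟨z, hz⟩ := (red_sub_eq_zero_iff 𝓛.d x' x).1 hxx'
    have : x = x' - (3 : ℤ) • z := by rw [← hz]; abel
    rw [this]
    exact L.sub_mem hx' (hL3 z)

/-- **`hcyc`** for `X_M = red⁻¹(W)` from `dim W + 1 = d`: `X = ℤx + X_M` for every `x ∉ X_M`. -/
theorem hcyc_of_subspace (hdim : Module.finrank (ZMod 3) W + 1 = 𝓛.d) :
    ∀ x, x ∉ (W.restrictScalars ℤ).comap (red 𝓛.d) → ∀ y, ∃ a : ℤ, y - a • x ∈ (W.restrictScalars ℤ).comap (red 𝓛.d) := by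
  intro x hx y
  rw [mem_comap_red_iff] at hx
  -- `W ⊔ span {red x} = ⊤` by dimension count
  have htop : W ⊔ (ZMod 3) ∙ red 𝓛.d x = ⊤ := by
    apply Submodule.eq_top_of_finrank_eq
    rw [Module.finrank_fin_fun]
    have hlt : Module.finrank (ZMod 3) W < Module.finrank (ZMod 3) ↥(W ⊔ (ZMod 3) ∙ red 𝓛.d x) := by
      apply Submodule.finrank_lt_finrank_of_lt
      rw [lt_iff_le_and_ne]
      refine ⟨le_sup_left, fun h => hx ?_⟩
      rw [h]
      exact Submodule.mem_sup_right (Submodule.mem_span_singleton_self _)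
    have hle : Module.finrank (ZMod 3) ↥(W ⊔ (ZMod 3) ∙ red 𝓛.d x) ≤ 𝓛.d := by
      calc Module.finrank (ZMod 3) ↥(W ⊔ (ZMod 3) ∙ red 𝓛.d x)
          ≤ Module.finrank (ZMod 3) (Fin 𝓛.d → ZMod 3) := Submodule.finrank_le _
        _ = 𝓛.d := Module.finrank_fin_fun _
    omega
  have hy : red 𝓛.d y ∈ W ⊔ (ZMod 3) ∙ red 𝓛.d x := by rw [htop]; trivial
  rw [Submodule.mem_sup] at hy
  obtain ⟨w, hw, z, hz, hwz⟩ := hy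
  rw [Submodule.mem_span_singleton] at hz
  obtain ⟨c, rfl⟩ := hz
  refine ⟨(c.val : ℤ), ?_⟩
  rw [mem_comap_red_iff, map_sub, map_zsmul]
  have : ((c.val : ℤ)) • red 𝓛.d x = c • red 𝓛.d x := by
    rw [natCast_zsmul, ← Nat.cast_smul_eq_nsmul (ZMod 3), ZMod.natCast_zmod_val]
  rw [this, ← hwz, add_sub_cancel_right]
  exact hw

end Transfer

end Summit.BirchSwinnertonDyer.BirchSwinnertonDyer.Theorems.CartanTorusCubeCut.PS
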